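import Summits.Ventures.QEC.Census.FoldDriver
import HarnessLib

/-!
# Fold enumeration — column equivariance from generators, the list-free lift, and the LIFT shortcut

Cell `qec`, PARTITION row type-11 ("kernel C"), soundness layer 7 of `Census/FoldDefs.lean`:
* `TCode.colEquiv_of_gens` — column equivariance under all translations from the two generators;
* `complete_lift'` — the list-free form of the completeness lift (when the small level's fibre property
  is known for EVERY small kernel word, no translation is needed);
* `goodFib_of_liftCheck` — THE LIFT: if `st` is a big kernel word folding onto `v`, every big kernel word
  `u` of weight `≤ W` folding onto `v` is `st ⊕ double c` with `c` a small kernel word of weight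
  `≤ (W + |st|)/2`; so checking the candidates built from a complete list of light small kernel words
  establishes the fibre property of `v` (used for the weight-6 row class, whose fibre is too large to scan).
-/

namespace Summit.Ventures.QEC.Census.Fold

open Summit.Ventures.QEC.Census

/-! ## Row translations compose; column equivariance from generators -/

/-- `transRow_eq_transIdx`: transRow eq transIdx (auxiliary lemma of the fold-certificate soundness chain). -/
theorem transRow_eq_transIdx {l m da db R : ℕ} (hR : R < l * m) : transRow l m da db R = transIdx l m da db R := by
  unfold transRow transIdx
  rw [Nat.div_eq_of_lt hR, Nat.mod_eq_of_lt hR]; simp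

/-- `transRow_lt`: transRow lt (auxiliary lemma of the fold-certificate soundness chain). -/
theorem transRow_lt {l m : ℕ} (hl : 0 < l) (hm : 0 < m) (da db R : ℕ) : transRow l m da db R < l * m := by
  unfold transRow; exact lt_lm (Nat.mod_lt _ hl) (Nat.mod_lt _ hm)

/-- `transRowW_transRowW`: transRowW transRowW (auxiliary lemma of the fold-certificate soundness chain). -/
theorem transRowW_transRowW {l m : ℕ} (hl : 0 < l) (hm : 0 < m) (da db da' db' y : ℕ) :
    transRowW l m da db (transRowW l m da' db' y) = transRowW l m (da + da') (db + db') y := by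
  rw [transRowW, transRowW, lin_lin, transRowW]
  refine lin_congr (i0 := 0) (fun R hR => ?_) y
  have h1 := transRow_lt hl hm da' db' R
  have := lin_two_pow (fun R => 2 ^ transRow l m da db R) (l * m) 0 _ h1
  rw [Nat.zero_add] at this ⊢
  rw [this, transRow_eq_transIdx h1, transRow_eq_transIdx hR, transRow_eq_transIdx hR, transIdx_comp hl hm]

/-- `transRowW_zero`: transRowW zero (auxiliary lemma of the fold-certificate soundness chain). -/
theorem transRowW_zero {l m : ℕ} (hl : 0 < l) (hm : 0 < m) {y : ℕ} (hy : y < 2 ^ (l * m)) : transRowW l m 0 0 y = y := by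
  rw [transRowW, lin_congr (i0 := 0) (h := fun R => 2 ^ R) (fun R hR => by
      rw [Nat.zero_add, transRow_eq_transIdx hR, transIdx_zero hl hm (by omega)]) y,
    lin_pow_self, Nat.mod_eq_of_lt hy]

/-- Column equivariance under every translation from the two generator translations. -/
theorem TCode.colEquiv_of_gens (C : TCode) (hl : 0 < C.l) (hm : 0 < C.m)
    (hcol : ∀ J, J < C.n → C.col J < 2 ^ (C.l * C.m)) (hx : C.ColEquiv 1 0) (hy : C.ColEquiv 0 1) :
    ∀ da db, C.ColEquiv da db := by
  have hn : C.n = 2 * (C.l * C.m) := rfl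
  have step : ∀ da db da' db', C.ColEquiv da db → C.ColEquiv da' db' → C.ColEquiv (da + da') (db + db') := by
    intro da db da' db' h h' J hJ
    rw [← transIdx_comp hl hm, h _ (by rw [hn]; exact transIdx_lt hl hm _ _ (hn ▸ hJ)), h' J hJ,
      transRowW_transRowW hl hm]
  have h0 : C.ColEquiv 0 0 := fun J hJ => by
    rw [transIdx_zero hl hm (hn ▸ hJ), transRowW_zero hl hm (hcol J hJ)]
  have hX : ∀ da, C.ColEquiv da 0 := by
    intro da
    induction da with
    | zero => exact h0
    | succ d ih => have := step 1 0 d 0 hx ih; rwa [Nat.add_comm 1 d] at this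
  intro da db
  induction db with
  | zero => exact hX da
  | succ d ih => have := step 0 1 da d hy ih; rwa [Nat.zero_add, Nat.add_comm 1 d] at this

/-! ## The list-free lift -/

/-- If the fibre property holds over EVERY small kernel word of weight `≤ W`, `Q` holds for every big
kernel word of weight `≤ W`. -/
theorem complete_lift' {G : Geo} (hG : G.OK) {Cb Cs : TCode} (hCF : G.ColFold Cb Cs) {W : ℕ} {Q : ℕ → Prop}
    (hall : ∀ s, s < 2 ^ G.ns → Cs.ker G.ns s → popc G.ns s ≤ W → GoodFib G Cb W Q s) :
    ∀ u, u < 2 ^ G.n → Cb.ker G.n u → popc G.n u ≤ W → Q u := by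
  intro u hu hker hwt
  exact hall _ (Geo.foldW_lt hG u) (Geo.ker_foldW hG hCF hker) ((Geo.popc_foldW_le hG hu).trans hwt) u hu hker hwt rfl

/-! ## The LIFT -/

namespace Geo

variable {G : Geo}

/-- Translating by the generator moves the section placement to the partner placement. -/
theorem transW_gen_embW (hS : G.Shape) (hG : G.OK) (y : ℕ) : transW G.l G.m G.gen.1 G.gen.2 (G.embW y) = G.parW y := by
  rw [embW, map_lin_of_xor (transW G.l G.m G.gen.1 G.gen.2) (lin_zero _ _ _) (transW_xor _ _), parW]
  exact lin_congr (i0 := 0) (fun j hj => by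
    rw [Nat.zero_add, transW_two_pow _ _ (hG.emb_lt j hj),
      ← partner_eq_transIdx hS (hG.emb_lt j hj)]) y

/-- … and the partner placement to the section placement. -/
theorem transW_gen_parW (hS : G.Shape) (hG : G.OK) (y : ℕ) : transW G.l G.m G.gen.1 G.gen.2 (G.parW y) = G.embW y := by
  rw [parW, map_lin_of_xor (transW G.l G.m G.gen.1 G.gen.2) (lin_zero _ _ _) (transW_xor _ _), embW]
  exact lin_congr (i0 := 0) (fun j hj => by
    rw [Nat.zero_add, transW_two_pow _ _ (hG.partner_lt _ (hG.emb_lt j hj)),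
      ← partner_eq_transIdx hS (hG.partner_lt _ (hG.emb_lt j hj)), hG.partner_partner _ (hG.emb_lt j hj)]) y

/-- A word with trivial fold is the double of its section part. -/
theorem eq_double_of_foldW_eq_zero (hG : G.OK) {w : ℕ} (hw : w < 2 ^ G.n) (h0 : G.foldW w = 0) : w = G.double (G.aPart w) := by
  have hab : G.aPart w = G.bPart w := by
    have := foldW_eq_parts (G := G) w
    rw [h0] at this
    have := congrArg (· ^^^ G.bPart w) this
    simpa [Nat.xor_assoc] using this.symm
  rw [double]
  conv_lhs => rw [recon hG hw]
  rw [hab]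

/-- ROW words `y < 2^{lm}` behave as big words of block `0`: `transRowW` is `transW` … -/
theorem transRowW_eq_transW {da db y : ℕ} (hy : y < 2 ^ (G.l * G.m)) :
    transRowW G.l G.m da db y = transW G.l G.m da db y :=
  lin_eq_lin_of_lt _ _ hy (by omega) (fun R hR => by rw [transRow_eq_transIdx hR])

/-- … and `foldRowW` is `foldW`. -/
theorem foldRowW_eq_foldW {y : ℕ} (hy : y < 2 ^ (G.l * G.m)) : G.foldRowW y = G.foldW y := by
  rw [foldRowW, foldW, Geo.r]
  refine lin_eq_lin_of_lt _ _ hy (by unfold Geo.n; omega) (fun R hR => ?_)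
  unfold foldRow foldIdx
  rw [Nat.div_eq_of_lt hR, Nat.mod_eq_of_lt hR]; simp

/-- Bits of placements at section points. -/
theorem testBit_embW_emb (hG : G.OK) (x : ℕ) {j : ℕ} (hj : j < G.ns) : (G.embW x).testBit (G.emb j) = x.testBit j := by
  rcases hb : x.testBit j with _ | _
  · rw [Bool.eq_false_iff]; intro h
    obtain ⟨j', hj', hb', he⟩ := (testBit_embW hG).1 h
    have := emb_inj hG hj' hj he; subst this
    rw [hb] at hb'; exact Bool.false_ne_true hb'
  · exact (testBit_embW hG).2 ⟨j, hj, hb, rfl⟩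

/-- `testBit_parW_emb`: testBit parW emb (auxiliary lemma of the fold-certificate soundness chain). -/
theorem testBit_parW_emb (hG : G.OK) (z : ℕ) {j : ℕ} (hj : j < G.ns) : (G.parW z).testBit (G.emb j) = false := by
  rw [Bool.eq_false_iff]; intro h
  obtain ⟨j', hj', -, he⟩ := (testBit_parW hG).1 h
  have := hG.fold_partner _ (hG.emb_lt j' hj')
  rw [he, hG.fold_emb j hj, hG.fold_emb j' hj'] at this
  subst this
  exact hG.partner_emb_ne _ hj' he

/-- **Doubles in the big kernel come from the small kernel** (given the column-fold identity and the
generator equivariance). -/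
theorem ker_of_double_ker (hS : G.Shape) (hG : G.OK) {Cb Cs : TCode} (hCF : G.ColFold Cb Cs) (heq : Cb.ColEquiv G.gen.1 G.gen.2)
    (hCb : Cb.l = G.l ∧ Cb.m = G.m) (hcol : ∀ J, J < Cb.n → Cb.col J < 2 ^ (Cb.l * Cb.m))
    {c : ℕ} (_hc : c < 2 ^ G.ns) (h : Cb.ker G.n (G.double c)) : Cs.ker G.ns c := by
  unfold TCode.ker at *
  have hn : Cb.n = G.n := by rw [TCode.n, Geo.n, hCb.1, hCb.2]
  set y := lin Cb.col G.n 0 (G.embW c) with hy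
  have hylt : y < 2 ^ (G.l * G.m) := by
    rw [hy, ← hCb.1, ← hCb.2, ← hn]; exact lin_lt_two_pow _ _ _ hcol _
  -- syndrome of the partner placement is the generator-translate of y
  have hy2 : lin Cb.col G.n 0 (G.parW c) = transW G.l G.m G.gen.1 G.gen.2 y := by
    have e := Cb.syn_transW (hCb.1 ▸ hS.l_pos) (hCb.2 ▸ hS.m_pos) heq (G.embW c)
    rw [hn, hCb.1, hCb.2, transW_gen_embW hS hG] at e
    rw [e, ← hy, transRowW_eq_transW hylt]
  -- double c ∈ ker: y ⊕ T y = 0, so T y = y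
  rw [double, lin_xor, ← hy, hy2] at h
  have hfix : transW G.l G.m G.gen.1 G.gen.2 y = y := by
    have := congrArg (· ^^^ transW G.l G.m G.gen.1 G.gen.2 y) h
    simp only [Nat.xor_assoc, Nat.xor_self, Nat.xor_zero, Nat.zero_xor] at this
    exact this.symm
  -- decompose y on block 0: y = embW a ⊕ parW b, and T y = parW a ⊕ embW b
  have hyn : y < 2 ^ G.n := lt_of_lt_of_le hylt (Nat.pow_le_pow_right (by norm_num) (by unfold Geo.n; omega))
  set a := G.aPart y
  set b := G.bPart y
  have hrec : y = G.embW a ^^^ G.parW b := recon hG hyn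
  have hT : transW G.l G.m G.gen.1 G.gen.2 y = G.parW a ^^^ G.embW b := by
    conv_lhs => rw [hrec]
    rw [transW_xor, transW_gen_embW hS hG, transW_gen_parW hS hG]
  -- compare bits at section points: a = b
  have hab : a = b := by
    apply Nat.eq_of_testBit_eq; intro j
    by_cases hj : j < G.ns
    · have e1 : y.testBit (G.emb j) = a.testBit j := by
        rw [hrec, Nat.testBit_xor, testBit_embW_emb hG a hj, testBit_parW_emb hG b hj, Bool.xor_false]
      have e2 : y.testBit (G.emb j) = b.testBit j := by
        rw [← hfix, hT, Nat.testBit_xor, testBit_parW_emb hG a hj, testBit_embW_emb hG b hj, Bool.false_xor]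
      rw [← e1, e2]
    · rw [not_lt] at hj
      rw [Nat.testBit_lt_two_pow (lt_of_lt_of_le (aPart_lt hG y) (Nat.pow_le_pow_right (by norm_num) hj)),
        Nat.testBit_lt_two_pow (lt_of_lt_of_le (bPart_lt hG y) (Nat.pow_le_pow_right (by norm_num) hj))]
  -- the small syndrome of c is foldRowW y = foldW y = a ⊕ b = 0
  have hsyn : lin Cs.col G.ns 0 c = G.foldRowW y := by
    rw [hy, embW, lin_lin, map_lin_of_xor G.foldRowW (lin_zero _ _ _) (foldRowW_xor G)]
    exact lin_congr (i0 := 0) (fun j hj => by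
      rw [Nat.zero_add, lin_two_pow _ _ 0 _ (hG.emb_lt j hj), Nat.zero_add, hCF _ (hG.emb_lt j hj), hG.fold_emb j hj]) c
  rw [hsyn, foldRowW_eq_foldW hylt, foldW_eq_parts]
  change a ^^^ b = 0
  rw [hab, Nat.xor_self]

/-- **THE LIFT.**  With a known big kernel word `st` folding onto `v`, and `Cands` complete for small
kernel words of weight `≤ B` where `W + |st| ≤ 2B + 1`, the passing `liftCheck` establishes the fibre
property of `v`. -/
theorem goodFib_of_liftCheck (hS : G.Shape) (hG : G.OK) {Cb Cs : TCode} (hCF : G.ColFold Cb Cs) (heq : Cb.ColEquiv G.gen.1 G.gen.2)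
    (hCb : Cb.l = G.l ∧ Cb.m = G.m) (hcol : ∀ J, J < Cb.n → Cb.col J < 2 ^ (Cb.l * Cb.m))
    {W B st v : ℕ} (hst : st < 2 ^ G.n) (hstker : Cb.ker G.n st) (hstfold : G.foldW st = v) (hB : W + popc G.n st ≤ 2 * B + 1)
    {Cands : List ℕ} (hCands : ∀ c, c < 2 ^ G.ns → Cs.ker G.ns c → popc G.ns c ≤ B → Matched G.ls G.ms Cands c)
    {k : List ℕ → Bool} {Q : ℕ → Prop}
    (hk : ∀ S', (∀ J ∈ S', J < G.n) → S'.length = popc G.n (maskOf S') → k S' = true → Q (maskOf S'))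
    (h : liftCheck G W st Cands k = true) : GoodFib G Cb W Q v := by
  intro u hu hker hwt hfold
  -- w := u ⊕ st has trivial fold, so w = double c
  have hwlt : u ^^^ st < 2 ^ G.n := Nat.xor_lt_two_pow hu hst
  have hwker : Cb.ker G.n (u ^^^ st) := by unfold TCode.ker at *; rw [lin_xor, hker, hstker, Nat.xor_zero]
  have hwfold : G.foldW (u ^^^ st) = 0 := by rw [foldW_xor, hfold, hstfold, Nat.xor_self]
  set c := G.aPart (u ^^^ st) with hc
  have hwd : u ^^^ st = G.double c := eq_double_of_foldW_eq_zero hG hwlt hwfold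
  have hclt : c < 2 ^ G.ns := aPart_lt hG _
  have hcker : Cs.ker G.ns c := ker_of_double_ker hS hG hCF heq hCb hcol hclt (hwd ▸ hwker)
  -- weight of c
  have hcw : popc G.ns c ≤ B := by
    have h1 : popc G.n (u ^^^ st) = 2 * popc G.ns c := by
      rw [hwd, double, popc_xor_of_and_eq_zero (embW_and_parW hG _ _), popc_embW hG, popc_parW hG]; ring
    have h2 := popc_xor_add G.n u st
    omega
  -- so c translates onto a candidate
  obtain ⟨c₀, hc₀, da, db, htr⟩ := hCands c hclt hcker hcw
  have hls := hS.ls_pos; have hms := hS.ms_pos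
  have hcinv : c = transW G.ls G.ms (G.ls - da % G.ls) (G.ms - db % G.ms) c₀ := by
    rw [← htr, transW_inv hls hms (by rw [← ns_eq]; exact hclt)]
  set da' := (G.ls - da % G.ls) % G.ls with hda'
  set db' := (G.ms - db % G.ms) % G.ms with hdb'
  have hcand : c = transW G.ls G.ms da' db' c₀ := by rw [hda', hdb', transW_mod]; exact hcinv
  -- the check covered (c₀, da', db')
  rw [liftCheck, List.all_eq_true] at h
  have h1 := h c₀ hc₀
  rw [List.all_eq_true] at h1
  have h2 := h1 da' (List.mem_range.2 (Nat.mod_lt _ hls))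
  rw [List.all_eq_true] at h2
  have h3 := h2 db' (List.mem_range.2 (Nat.mod_lt _ hms))
  simp only [Bool.or_eq_true, Bool.not_eq_true', decide_eq_false_iff_not] at h3
  have hu_eq : u = st ^^^ G.double (transW G.ls G.ms da' db' c₀) := by
    rw [← hcand, ← hwd, ← Nat.xor_assoc, Nat.xor_comm st u, Nat.xor_assoc, Nat.xor_self, Nat.xor_zero]
  rcases h3 with h3 | h3
  · exact absurd (hu_eq ▸ hwt) h3
  · have hult : st ^^^ G.double (transW G.ls G.ms da' db' c₀) < 2 ^ G.n := hu_eq ▸ hu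
    have := hk _ (fun J hJ => lt_of_mem_bitsOf hJ)
      (by rw [maskOf_bitsOf_zero _ _ hult, length_bitsOf]) h3
    rwa [maskOf_bitsOf_zero _ _ hult, ← hu_eq] at this

end Geo

end Summit.Ventures.QEC.Census.Fold
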